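import Literature.MathematicalPhysics.QuantumLattice.HubbardUniformOneParticleCost
import Literature.MathematicalPhysics.QuantumLattice.ReducedBCSTorus
import HarnessLib

/-!
# Commutators of the Hubbard Hamiltonian with smeared and Bloch-mode creation operators,
# and the dressed creation operator `Σ_z g(z) n_{z↓} c†_{z↑}`

Topic `MathematicalPhysics/QuantumLattice` (family `hubbard`); proof-only operator bookkeeping on the
tree's Jordan–Wigner Fock space, written for the a-priori parity-gap ceiling
`HubbardParityGapCeiling.lean` (route `HubbardSuperconductivity/ParityGapRigidity`, items
`GappedWindow` / `NoUniformParityGap`).  For the Hubbard Hamiltonian `H = hamiltonian G t U` on an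
arbitrary finite graph and a coefficient function `g : Λ → ℂ`:

* `hamiltonian_commutator_sum_creation` — `[H, Σ_z g(z) c†_{z↑}] = -t Σ_x (Σ_{z ∼ x} g(z)) c†_{x↑}
  + U Σ_z g(z) n_{z↓} c†_{z↑}` (linear combination of the tree's `hamiltonian_mul_creation_sub`);
* `dressed_pair_anticommutator`, `dressed_anticommutator` — the DRESSED creation operator
  `T_g = Σ_z g(z) n_{z↓} c†_{z↑}` (the interaction part of the commutator) is a quasi-fermion:
  `T_g† T_g + T_g T_g† = Σ_z |g(z)|² n_{z↓}`;
* `normSq_dressed_mulVec_le`, `normSq_dressed_conjTranspose_mulVec_le` — hence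
  `‖T_g ψ‖², ‖T_g† ψ‖² ≤ (Σ_z |g(z)|²) ‖ψ‖²`;
* on the torus `(ℤ/Lℤ)²` with the normalised plane wave `g(z) = L⁻¹ χ_k(z)` (`L ≥ 3`):
  `hubbardTorus_commutator_momentumCreation` —
  `[H, c†_{k↑}] = ε_L(k) c†_{k↑} + U T_k`, `T_k = Σ_z L⁻¹χ_k(z) n_{z↓} c†_{z↑}`, and its adjoint
  `hubbardTorus_commutator_momentumAnnihilation`; `sum_normSq_planeWaveCoeff` — `Σ_z |L⁻¹χ_k(z)|² = 1`.

Everything is proved; no definitions, no named facts (the dressed operator is written out as the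
explicit sum in every statement).  Sources: H. Tasaki, *Physics and Mathematics of Quantum Many-Body
Systems* (Springer 2020) §9.3 (commutators of the Hubbard Hamiltonian); F. H. L. Essler et al., *The
One-Dimensional Hubbard Model* (CUP 2005) §2.1 eq. (2.8); O. Bratteli, D. W. Robinson, *Operator
Algebras and QSM 2* §5.2.1 (CAR).  Folklore finite-dimensional statements.

## Mathlib / tree search

Tree (REUSED): `hamiltonian_mul_creation_sub`, `numberOp_commutator_creation`,
`number_mul_creation_of_ne`, `annihilation_mul_number_of_ne`, `numberAt_commute`,
`numberAt_idempotent`, `numberAt_isHermitian`, `annihilation_mul_creation_add_torus`,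
`momentumCreation_eq_sum`, `sum_ite_torusGraph_adj_torusChar`, `torusFourierWeight_two`,
`norm_torusChar`, `ThermodynamicLimit.star_mulVec_dotProduct`, `ThermodynamicLimit.norm_toLp_sq`,
`ThermodynamicLimit.norm_toLp_mulVec_le`, `norm_annihilation_le_one`.
-/

noncomputable section

namespace Literature.MathematicalPhysics.QuantumLattice

open Matrix Finset HubbardWave0 ThermodynamicLimit Literature.Probability.LatticeModels
open scoped ComplexOrder ComplexConjugate Matrix.Norms.L2Operator InnerProductSpace

section General

variable {Λ : Type*} [LinearOrder Λ] [Fintype Λ] (G : SimpleGraph Λ) [DecidableRel G.Adj]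

/-- **`[H, c†(g)] = -t Σ_x (Σ_{z∼x} g z) c†_{x↑} + U Σ_z g(z) n_{z↓} c†_{z↑}`** for the smeared
spin-`↑` creation operator `c†(g) = Σ_z g(z) c†_{z↑}` and the Hubbard Hamiltonian
`H = hamiltonian G t U` (the tree's `hamiltonian_mul_creation_sub` summed against `g`).
Tasaki (2020) §9.3; Essler et al. (2005) §2.1 eq. (2.8). [folklore] -/
theorem hamiltonian_commutator_sum_creation (t U : ℝ) (g : Λ → ℂ) :
    hamiltonian G t U * (∑ z, g z • creation (orb z 0)) -
        (∑ z, g z • creation (orb z 0)) * hamiltonian G t U =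
      -(t : ℂ) • (∑ x, (∑ z, if G.Adj x z then g z else 0) • creation (orb x 0)) +
        (U : ℂ) • ∑ z, g z • (numberOp z 1 * creation (orb z 0)) := by
  classical
  -- `[H, c†_{z↑}]` site by site, with the down-spin partner `τ' = 1`
  have hz : ∀ z : Λ, hamiltonian G t U * creation (orb z 0) - creation (orb z 0) * hamiltonian G t U =
      -(t : ℂ) • (∑ x, if G.Adj x z then creation (orb x 0) else 0) +
        (U : ℂ) • (numberOp z 1 * creation (orb z 0)) := by
    intro z
    obtain ⟨τ', hτ', h⟩ := hamiltonian_mul_creation_sub G t U z 0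
    have hτ1 : τ' = 1 := by
      fin_cases τ'
      · exact absurd rfl hτ'
      · rfl
    rw [h, hτ1]
  -- linearity in `g`
  have hlin : hamiltonian G t U * (∑ z, g z • creation (orb z 0)) -
      (∑ z, g z • creation (orb z 0)) * hamiltonian G t U =
      ∑ z, g z • (hamiltonian G t U * creation (orb z 0) - creation (orb z 0) * hamiltonian G t U) := by
    rw [Finset.mul_sum, Finset.sum_mul, ← Finset.sum_sub_distrib]
    refine Finset.sum_congr rfl fun z _ => ?_
    rw [mul_smul_comm, smul_mul_assoc, smul_sub]
  rw [hlin]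
  simp only [hz, smul_add, Finset.sum_add_distrib]
  congr 1
  · -- hopping part: swap the two sums
    simp only [smul_comm (g _) (-(t : ℂ)), ← Finset.smul_sum]
    congr 1
    simp only [Finset.smul_sum, smul_ite, smul_zero]
    rw [Finset.sum_comm]
    refine Finset.sum_congr rfl fun x _ => ?_
    rw [Finset.sum_smul]
    refine Finset.sum_congr rfl fun z _ => ?_
    split_ifs <;> simp
  · simp only [smul_comm (g _) (U : ℂ), ← Finset.smul_sum]

omit [Fintype Λ] in
/-- **The dressed modes anticommute to the down-spin density, pair by pair**:
`(n_{z↓} c†_{z↑})† (n_{z'↓} c†_{z'↑}) + (n_{z'↓} c†_{z'↑}) (n_{z↓} c†_{z↑})† = δ_{zz'} n_{z↓}` —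
the number operators commute through the `↑`-operators of other orbitals, `{c_{z↑}, c†_{z'↑}} = δ_{zz'}`
and `n² = n`. Bratteli–Robinson II §5.2.1. [folklore] -/
theorem dressed_pair_anticommutator [Fintype Λ] (z z' : Λ) :
    annihilation (orb z 0) * numberOp z 1 * (numberOp z' 1 * creation (orb z' 0)) +
        numberOp z' 1 * creation (orb z' 0) * (annihilation (orb z 0) * numberOp z 1) =
      if z = z' then numberOp z 1 else 0 := by
  -- the four elementary (anti)commutations
  have hne1 : orb z' 1 ≠ orb z' 0 := by simp
  have hne2 : orb z 1 ≠ orb z' 0 := by simp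
  have hne3 : orb z' 1 ≠ orb z 0 := by simp
  have hNC' : numberOp z' 1 * creation (orb z' 0) = creation (orb z' 0) * numberOp z' 1 :=
    number_mul_creation_of_ne hne1
  have hNC : numberOp z 1 * creation (orb z' 0) = creation (orb z' 0) * numberOp z 1 :=
    number_mul_creation_of_ne hne2
  have hAN : annihilation (orb z 0) * numberOp z' 1 = numberOp z' 1 * annihilation (orb z 0) :=
    annihilation_mul_number_of_ne hne3
  have hNN : numberOp z' 1 * numberOp z 1 = numberOp z 1 * numberOp z' 1 :=
    (numberAt_commute (orb z' 1) (orb z 1)).eq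
  have h1 : annihilation (orb z 0) * numberOp z 1 * (numberOp z' 1 * creation (orb z' 0)) =
      annihilation (orb z 0) * creation (orb z' 0) * (numberOp z 1 * numberOp z' 1) := by
    rw [hNC', mul_assoc, ← mul_assoc (numberOp z 1), hNC, mul_assoc, mul_assoc]
  have h2 : numberOp z' 1 * creation (orb z' 0) * (annihilation (orb z 0) * numberOp z 1) =
      creation (orb z' 0) * annihilation (orb z 0) * (numberOp z 1 * numberOp z' 1) := by
    rw [hNC', mul_assoc, ← mul_assoc (numberOp z' 1), ← hAN, mul_assoc, hNN, ← mul_assoc,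
      ← mul_assoc]
  rw [h1, h2, ← add_mul, annihilation_mul_creation_add_creation_mul_annihilation_holds]
  by_cases hzz : z = z'
  · subst hzz
    rw [if_pos rfl, if_pos rfl, one_mul]
    exact (numberAt_idempotent (orb z 1)).eq
  · rw [if_neg (fun h => hzz (orb_eq_orb_iff.1 h).1), if_neg hzz, zero_mul]

/-- **The dressed creation operator is a quasi-fermion**: for `T = Σ_z g(z) n_{z↓} c†_{z↑}`,
`T† T + T T† = Σ_z |g(z)|² n_{z↓}`. Bratteli–Robinson II §5.2.1 (CAR for smeared operators).
[folklore] -/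
theorem dressed_anticommutator (g : Λ → ℂ) :
    (∑ z, g z • (numberOp z 1 * creation (orb z 0)))ᴴ * (∑ z, g z • (numberOp z 1 * creation (orb z 0))) +
        (∑ z, g z • (numberOp z 1 * creation (orb z 0))) * (∑ z, g z • (numberOp z 1 * creation (orb z 0)))ᴴ =
      ∑ z, ((‖g z‖ ^ 2 : ℝ) : ℂ) • numberOp z 1 := by
  have hn : ∀ z : Λ, (numberOp z 1 : Matrix (Finset (Orb Λ)) (Finset (Orb Λ)) ℂ)ᴴ = numberOp z 1 :=
    fun z => (numberAt_isHermitian (orb z 1)).eq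
  have hT : (∑ z, g z • (numberOp z 1 * creation (orb z 0)))ᴴ =
      ∑ z, star (g z) • (annihilation (orb z 0) * numberOp z 1) := by
    rw [conjTranspose_sum]
    refine Finset.sum_congr rfl fun z _ => ?_
    rw [conjTranspose_smul, conjTranspose_mul, creation_conjTranspose, hn]
  rw [hT, Finset.sum_mul_sum, Finset.sum_mul_sum]
  conv_lhs => arg 2; rw [Finset.sum_comm]
  rw [← Finset.sum_add_distrib]
  have hsq : ∀ z : Λ, star (g z) * g z = ((‖g z‖ ^ 2 : ℝ) : ℂ) := fun z => by
    rw [Complex.star_def, Complex.conj_mul', Complex.ofReal_pow]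
  refine Finset.sum_congr rfl fun z _ => ?_
  rw [← Finset.sum_add_distrib]
  have hterm : ∀ z' : Λ,
      star (g z) • (annihilation (orb z 0) * numberOp z 1) * (g z' • (numberOp z' 1 * creation (orb z' 0))) +
          g z' • (numberOp z' 1 * creation (orb z' 0)) * (star (g z) • (annihilation (orb z 0) * numberOp z 1)) =
        if z = z' then ((‖g z‖ ^ 2 : ℝ) : ℂ) • numberOp z 1 else 0 := by
    intro z'
    rw [smul_mul_smul_comm, smul_mul_smul_comm, mul_comm (g z') (star (g z)), ← smul_add,
      dressed_pair_anticommutator]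
    split_ifs with h
    · subst h; rw [hsq]
    · rw [smul_zero]
  simp only [hterm, Finset.sum_ite_eq, Finset.mem_univ, if_true]

/-- `Re ⟨ψ, n_{xσ} ψ⟩ ≤ ⟨ψ, ψ⟩`: the occupation of an orbital is at most one
(`⟨ψ, c†c ψ⟩ = ‖c ψ‖²`, `‖c‖ ≤ 1`). Bratteli–Robinson II §5.2.1. [folklore] -/
theorem re_star_dotProduct_numberOp_mulVec_le (x : Λ) (σ : Fin 2) (ψ : Fock (Orb Λ)) :
    (star ψ ⬝ᵥ (numberOp x σ *ᵥ ψ)).re ≤ (star ψ ⬝ᵥ ψ).re := by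
  classical
  have hq : star (annihilation (orb x σ) *ᵥ ψ) ⬝ᵥ (annihilation (orb x σ) *ᵥ ψ) =
      star ψ ⬝ᵥ (numberOp x σ *ᵥ ψ) := by
    rw [star_mulVec_dotProduct, annihilation_conjTranspose, mulVec_mulVec]
    rfl
  rw [← hq, ← norm_toLp_sq, ← norm_toLp_sq]
  have h := norm_toLp_mulVec_le (annihilation (orb x σ)) ψ
  have h1 : ‖(annihilation (orb x σ) : Matrix (Finset (Orb Λ)) (Finset (Orb Λ)) ℂ)‖ ≤ 1 :=
    norm_annihilation_le_one _
  have h0 : 0 ≤ ‖(WithLp.toLp 2 ψ : EuclideanSpace ℂ (Finset (Orb Λ)))‖ := norm_nonneg _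
  have h2 : ‖(WithLp.toLp 2 (annihilation (orb x σ) *ᵥ ψ) : EuclideanSpace ℂ (Finset (Orb Λ)))‖ ≤
      ‖(WithLp.toLp 2 ψ : EuclideanSpace ℂ (Finset (Orb Λ)))‖ :=
    h.trans ((mul_le_mul_of_nonneg_right h1 h0).trans (one_mul _).le)
  exact pow_le_pow_left₀ (norm_nonneg _) h2 2

/-- **Norm bound for the dressed creation operator**: with `T = Σ_z g(z) n_{z↓} c†_{z↑}`,
`‖T ψ‖² ≤ (Σ_z |g(z)|²) ‖ψ‖²` (`T†T ≤ T†T + TT† = Σ |g|² n_{↓} ≤ Σ |g|²`).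
Bratteli–Robinson II §5.2.1. [folklore] -/
theorem normSq_dressed_mulVec_le (g : Λ → ℂ) (ψ : Fock (Orb Λ)) :
    (star ((∑ z, g z • (numberOp z 1 * creation (orb z 0))) *ᵥ ψ) ⬝ᵥ
        ((∑ z, g z • (numberOp z 1 * creation (orb z 0))) *ᵥ ψ)).re ≤
      (∑ z, ‖g z‖ ^ 2) * (star ψ ⬝ᵥ ψ).re := by
  set T : Matrix (Finset (Orb Λ)) (Finset (Orb Λ)) ℂ := ∑ z, g z • (numberOp z 1 * creation (orb z 0))
    with hTdef
  have hanti := dressed_anticommutator g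
  rw [← hTdef] at hanti
  -- `⟨Tψ, Tψ⟩ + ⟨T†ψ, T†ψ⟩ = Σ |g|² ⟨ψ, n ψ⟩`
  have hsum : star (T *ᵥ ψ) ⬝ᵥ (T *ᵥ ψ) + star (Tᴴ *ᵥ ψ) ⬝ᵥ (Tᴴ *ᵥ ψ) =
      ∑ z, ((‖g z‖ ^ 2 : ℝ) : ℂ) * (star ψ ⬝ᵥ (numberOp z 1 *ᵥ ψ)) := by
    rw [star_mulVec_dotProduct T ψ, star_mulVec_dotProduct Tᴴ ψ, conjTranspose_conjTranspose,
      mulVec_mulVec, mulVec_mulVec, ← dotProduct_add, ← add_mulVec, hanti, Matrix.sum_mulVec,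
      dotProduct_sum]
    refine Finset.sum_congr rfl fun z _ => ?_
    rw [smul_mulVec, dotProduct_smul, smul_eq_mul]
  have hre := congrArg Complex.re hsum
  rw [Complex.add_re, Complex.re_sum] at hre
  have h2 : 0 ≤ (star (Tᴴ *ᵥ ψ) ⬝ᵥ (Tᴴ *ᵥ ψ)).re := by
    rw [← norm_toLp_sq]; positivity
  have h3 : ∑ z, (((‖g z‖ ^ 2 : ℝ) : ℂ) * (star ψ ⬝ᵥ (numberOp z 1 *ᵥ ψ))).re ≤
      ∑ z, ‖g z‖ ^ 2 * (star ψ ⬝ᵥ ψ).re := by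
    refine Finset.sum_le_sum fun z _ => ?_
    rw [Complex.re_ofReal_mul]
    exact mul_le_mul_of_nonneg_left (re_star_dotProduct_numberOp_mulVec_le z 1 ψ) (sq_nonneg _)
  rw [← Finset.sum_mul] at h3
  linarith

/-- **Norm bound for the adjoint dressed operator**: `‖T† ψ‖² ≤ (Σ_z |g(z)|²) ‖ψ‖²`.
Bratteli–Robinson II §5.2.1. [folklore] -/
theorem normSq_dressed_conjTranspose_mulVec_le (g : Λ → ℂ) (ψ : Fock (Orb Λ)) :
    (star ((∑ z, g z • (numberOp z 1 * creation (orb z 0)))ᴴ *ᵥ ψ) ⬝ᵥ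
        ((∑ z, g z • (numberOp z 1 * creation (orb z 0)))ᴴ *ᵥ ψ)).re ≤
      (∑ z, ‖g z‖ ^ 2) * (star ψ ⬝ᵥ ψ).re := by
  set T : Matrix (Finset (Orb Λ)) (Finset (Orb Λ)) ℂ := ∑ z, g z • (numberOp z 1 * creation (orb z 0))
    with hTdef
  have hanti := dressed_anticommutator g
  rw [← hTdef] at hanti
  have hsum : star (T *ᵥ ψ) ⬝ᵥ (T *ᵥ ψ) + star (Tᴴ *ᵥ ψ) ⬝ᵥ (Tᴴ *ᵥ ψ) =
      ∑ z, ((‖g z‖ ^ 2 : ℝ) : ℂ) * (star ψ ⬝ᵥ (numberOp z 1 *ᵥ ψ)) := by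
    rw [star_mulVec_dotProduct T ψ, star_mulVec_dotProduct Tᴴ ψ, conjTranspose_conjTranspose,
      mulVec_mulVec, mulVec_mulVec, ← dotProduct_add, ← add_mulVec, hanti, Matrix.sum_mulVec,
      dotProduct_sum]
    refine Finset.sum_congr rfl fun z _ => ?_
    rw [smul_mulVec, dotProduct_smul, smul_eq_mul]
  have hre := congrArg Complex.re hsum
  rw [Complex.add_re, Complex.re_sum] at hre
  have h2 : 0 ≤ (star (T *ᵥ ψ) ⬝ᵥ (T *ᵥ ψ)).re := by
    rw [← norm_toLp_sq]; positivity
  have h3 : ∑ z, (((‖g z‖ ^ 2 : ℝ) : ℂ) * (star ψ ⬝ᵥ (numberOp z 1 *ᵥ ψ))).re ≤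
      ∑ z, ‖g z‖ ^ 2 * (star ψ ⬝ᵥ ψ).re := by
    refine Finset.sum_le_sum fun z _ => ?_
    rw [Complex.re_ofReal_mul]
    exact mul_le_mul_of_nonneg_left (re_star_dotProduct_numberOp_mulVec_le z 1 ψ) (sq_nonneg _)
  rw [← Finset.sum_mul] at h3
  linarith

end General

/-! ### The torus: Bloch modes -/

section Torus

variable {L : ℕ} [NeZero L]

/-- **`[H, c†_{k↑}] = ε_L(k) c†_{k↑} + U T_k`** on the torus `(ℤ/Lℤ)²` (`L ≥ 3`, any real `U`), with
the band `ε_L(k) = -2(cos(2πk₁/L) + cos(2πk₂/L))` and the dressed operator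
`T_k = Σ_z L⁻¹χ_k(z) n_{z↓} c†_{z↑}`: the hopping part of `hamiltonian_commutator_sum_creation` is
diagonal on plane waves (`sum_ite_torusGraph_adj_torusChar`). Tasaki (2020) §9.3; Benfatto–Giuliani–
Mastropietro (2006) §1.2 (free propagator diagonal in momentum). [folklore] -/
theorem hubbardTorus_commutator_momentumCreation (hL : 3 ≤ L) (U : ℝ) (k : TorusSite 2 L) :
    hubbardTorus 2 L 1 U * momentumCreation k 0 - momentumCreation k 0 * hubbardTorus 2 L 1 U =
      ((torusBand L k : ℝ) : ℂ) • momentumCreation k 0 +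
        (U : ℂ) • ∑ z : FermionTorus 2 L, (torusFourierWeight 2 L * torusChar k z.toTorusSite) •
          (numberOp z 1 * creation (orb z 0)) := by
  classical
  rw [momentumCreation_eq_sum,
    show hubbardTorus 2 L 1 U = hamiltonian (fermionTorusGraph 2 L) 1 U from rfl,
    hamiltonian_commutator_sum_creation (fermionTorusGraph 2 L) 1 U]
  congr 1
  -- the hopping coefficient is `L⁻¹ · 2Σcos · χ_k(x)`
  have hcoef : ∀ x : FermionTorus 2 L,
      (∑ z : FermionTorus 2 L, if (fermionTorusGraph 2 L).Adj x z then
          torusFourierWeight 2 L * torusChar k z.toTorusSite else 0) =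
        torusFourierWeight 2 L * (((2 * ∑ i, Real.cos (latticeMomentum L k i) : ℝ) : ℂ) *
          torusChar k x.toTorusSite) := by
    intro x
    have hre : (∑ z : FermionTorus 2 L, if (fermionTorusGraph 2 L).Adj x z then
        torusFourierWeight 2 L * torusChar k z.toTorusSite else 0) =
        torusFourierWeight 2 L * ∑ z : FermionTorus 2 L,
          (if (torusGraph 2 L).Adj x.toTorusSite z.toTorusSite then torusChar k z.toTorusSite else 0) := by
      rw [Finset.mul_sum]
      refine Finset.sum_congr rfl fun z _ => ?_
      by_cases h : (torusGraph 2 L).Adj x.toTorusSite z.toTorusSite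
      · rw [if_pos ((fermionTorusGraph_adj x z).2 h), if_pos h]
      · rw [if_neg (fun h' => h ((fermionTorusGraph_adj x z).1 h')), if_neg h, mul_zero]
    rw [hre, FermionTorus.sum_eq_sum_torusSite]
    simp only [FermionTorus.toTorusSite_ofTorusSite]
    rw [sum_ite_torusGraph_adj_torusChar hL k x.toTorusSite]
  simp only [hcoef, Finset.smul_sum, smul_smul]
  refine Finset.sum_congr rfl fun x _ => ?_
  congr 1
  unfold torusBand
  push_cast
  ring

/-- **`[H, c_{k↑}] = -ε_L(k) c_{k↑} - U T_k†`** (adjoint of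
`hubbardTorus_commutator_momentumCreation`; `H` is Hermitian, `ε_L(k)` and `U` are real).
Tasaki (2020) §9.3. [folklore] -/
theorem hubbardTorus_commutator_momentumAnnihilation (hL : 3 ≤ L) (U : ℝ) (k : TorusSite 2 L) :
    hubbardTorus 2 L 1 U * momentumAnnihilation k 0 - momentumAnnihilation k 0 * hubbardTorus 2 L 1 U =
      -(((torusBand L k : ℝ) : ℂ) • momentumAnnihilation k 0) -
        (U : ℂ) • (∑ z : FermionTorus 2 L, (torusFourierWeight 2 L * torusChar k z.toTorusSite) •
          (numberOp z 1 * creation (orb z 0)))ᴴ := by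
  have h := congrArg conjTranspose (hubbardTorus_commutator_momentumCreation hL U k)
  have hH : (hubbardTorus 2 L 1 U)ᴴ = hubbardTorus 2 L 1 U :=
    (LiebThm1.hamiltonian_isHermitian (fermionTorusGraph 2 L) 1 U).eq
  have hs1 : star ((torusBand L k : ℝ) : ℂ) = ((torusBand L k : ℝ) : ℂ) := by simp
  have hs2 : star (U : ℂ) = (U : ℂ) := by simp
  rw [conjTranspose_sub, conjTranspose_mul, conjTranspose_mul, conjTranspose_add, conjTranspose_smul,
    conjTranspose_smul, momentumCreation_conjTranspose, hH, hs1, hs2] at h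
  -- `h : c H - H c = ε • c + U • Tᴴ`
  rw [← neg_sub, h, neg_add, sub_eq_add_neg]

/-- The normalised plane-wave coefficients have unit `ℓ²` mass: `Σ_z |L⁻¹ χ_k(z)|² = 1` on the
fermionic torus `(ℤ/Lℤ)²`. [folklore] -/
theorem sum_normSq_planeWaveCoeff (k : TorusSite 2 L) :
    ∑ z : FermionTorus 2 L, ‖torusFourierWeight 2 L * torusChar k z.toTorusSite‖ ^ 2 = 1 := by
  have hL0 : (L : ℝ) ≠ 0 := Nat.cast_ne_zero.2 (NeZero.ne L)
  have hterm : ∀ z : FermionTorus 2 L,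
      ‖torusFourierWeight 2 L * torusChar k z.toTorusSite‖ ^ 2 = ((L : ℝ) ^ 2)⁻¹ := by
    intro z
    rw [norm_mul, norm_torusChar, mul_one, torusFourierWeight_two, norm_inv, Complex.norm_natCast,
      inv_pow]
  simp only [hterm, Finset.sum_const, Finset.card_univ, nsmul_eq_mul]
  have hcard : (Fintype.card (FermionTorus 2 L) : ℝ) = (L : ℝ) ^ 2 := by
    rw [show Fintype.card (FermionTorus 2 L) = L ^ 2 by simp [FermionTorus, Fintype.card_fin]]
    push_cast
    ring
  rw [hcard, mul_inv_cancel₀ (pow_ne_zero 2 hL0)]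

end Torus


end Literature.MathematicalPhysics.QuantumLattice

end
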